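import Summits.ABC.IUTFork.Joshi.PrimitiveAnsatzPoints
import HarnessLib

/-!
# Joshi, *ATS II (local prototype)* §6.2 — the DEGREE-ONE LOCUS of the point carrier, the author's kernel REFUTATION of the
# hypothesis `PtSurjective` of `Joshi/PrimitiveAnsatzPoints`, and Lem. 6.2.2 re-derived WITHOUT it

Record file of the abc-iut cell, branch E (rung LADDER-ABC:A2.E; seat abc-iut-E-t2, gen 2) — AUTHOR'S VACUITY REPAIR of my own
`Joshi/PrimitiveAnsatzPoints.lean` (p435530, accepted 2026-08-26T09:40Z), filed in the same session. TAKES NO SIDE on [IUTchIII]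
Cor. 3.12, on Joshi's claims, or on Mochizuki's report on them; typed ≠ proved ≠ endorsed. Source: K. Joshi, arXiv:2303.01662 **v3**
[J-IIp] (UNREFEREED; bib `Joshi2023ATS2Local`; render `HOME/lit/renders/Joshi-arxiv-2303.01662/pNNNN.txt`, «p. N l. a–b»).

## The defect (found by the author, kernel-checked below) and what print says

`PeriodRingDatum.PtSurjective` typed the [FF18, Cor. 2.2.9] input of Lem. 6.2.2 (p. 15 l. 18–23 «one can find a unit `u` and an
`a ∈ 𝔪_F − {0}` such that `α·u = [a] − p`») as «EVERY element of the carrier type `Y` is `y_a` for some `0 ≠ a ∈ 𝔪_F`». Over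
abc-iut-E-t3's signature this is REFUTABLE (`not_ptSurjective`): the point map `pt : F → Y` is TOTAL («total on `F`, meaningful on
`𝔪_F ∖ {0}`», `Joshi/ThetaValuesLocus`) and `pt_frob : pt (a^p) = φ (pt a)` holds at EVERY `a`, so at `a = 1` the junk value `pt 1` is a
φ-FIXED point of `Y` (`frobY_pt_one`); but no genuine point `y_a` (`0 < |a|_F < 1`) is φ-fixed, since `φ(y_a) = y_{a^p}` and
`|p|_{K_{y_a}} = |a|_F ≠ |a|_F^p = |p|_{K_{y_{a^p}}}` (`absK_pt`; `frobY_ne_self_of_mem_classicalPts`). PRINT IS NOT AFFECTED: print's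
`|Y_{ℂ_p^♭,ℚ_p}|` consists of the `y_a` only ([FF18]; §6.6 p. 16 l. 29–36: the fibres of `Y → X` are the infinite orbits
`{([φⁿ(t)] − p) : n ∈ ℤ}` — no fixed points); the junk points are an artefact of the total `pt` of the typing. CONSEQUENCE: the three
statements of `Joshi/PrimitiveAnsatzPoints` that take `(h : PtSurjective)` — `PrototypeDatum.exists_tuple_first_eq`,
`heckeImage_nonempty`, `exists_idealTuple_first` — are VACUOUSLY true and are SUPERSEDED here; everything else in that file is
hypothesis-free or takes only `EtaPtTeich` (stated on admissible `a` only; untouched by this defect).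

## The repair (as printed ↦ as typed)

* [FF18, Cor. 2.2.9] as used in Lem. 6.2.2 ↦ the DEGREE-ONE LOCUS `PeriodRingDatum.classicalPts := {y_a : 0 ≠ a ∈ 𝔪_F} ⊆ Y` — the
  READING of print's `|Y_{F,ℚ_p}|` inside the carrier type (in print the locus is ALL of `|Y|`; over the signature it is the sub-locus
  of genuine points, and «every closed classical point is a `y_a`» holds on it by definition). DERIVED: it is Frobenius- and
  Galois-stable (`frobY_mem_classicalPts`, `galY_mem_classicalPts`), contains every coordinate of every tuple of `Σ̃_F`
  (`ansatzPt_mem_classicalPts`, `primitiveAnsatz_subset`), carries the Hecke-type correspondence (`heckeCorr_subset`), has NO φ-fixed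
  point (`frobY_ne_self_of_mem_classicalPts`) and misses the junk point `pt 1` (`pt_one_not_mem_classicalPts`) — whence `not_ptSurjective`.
* Lem. 6.2.2 (p. 15 l. 15–26) ↦ `exists_tuple_first_eq_of_mem` (every point OF THE LOCUS is the first coordinate of a tuple of `Σ̃_F`),
  `heckeImage_nonempty_of_mem`, `exists_idealTuple_first_of_mem` — DERIVED, hypothesis-free (resp. from `EtaPtTeich` for the ideal
  clause), replacing the three vacuous statements. [claim: Joshi2023ATS2Local, status: disputed]
-/

noncomputable section

open Set

namespace Summit.ABC.IUTFork.Joshi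

variable {F B E0 : Type} [Field F] [CommRing B] [Field E0] {Y : Type} {K : Y → Type} [∀ y, Field (K y)] {G : Type}

/-! ## 1. The degree-one locus `|Y_{F,ℚ_p}| ⊆ Y` of the carrier and its stability -/

namespace PeriodRingDatum

variable (D : PeriodRingDatum F B E0 Y K G)

/-- **The degree-one locus** `|Y_{F,ℚ_p}| = {y_a : 0 ≠ a ∈ 𝔪_F}` inside the carrier type `Y` (Prop. 6.2.1 (3) / [FF18, Cor. 2.2.9] as
used in Lem. 6.2.2, p. 15 l. 18–23: every closed classical point is the point of some `[a] − p`). DEFINITION — the READING of print's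
`|Y|` over a signature whose `pt` is total (junk values `pt 0`, `pt 1` lie outside it, `pt_one_not_mem_classicalPts`).
[claim: Joshi2023ATS2Local, status: disputed] -/
def classicalPts : Set Y := {y | ∃ a : F, a ≠ 0 ∧ D.absF a < 1 ∧ D.pt a = y}

/-- `y_a` is a classical point for admissible `a`. [folklore] -/
theorem pt_mem_classicalPts {a : F} (ha0 : a ≠ 0) (ha : D.absF a < 1) : D.pt a ∈ D.classicalPts := ⟨a, ha0, ha, rfl⟩

/-- The locus is FROBENIUS-STABLE: `φ(y_a) = y_{a^p}` (E-t3's `pt_frob`). DERIVED. [claim: Joshi2023ATS2Local, status: disputed] -/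
theorem frobY_mem_classicalPts {y : Y} (hy : y ∈ D.classicalPts) : D.frobY y ∈ D.classicalPts := by
  obtain ⟨a, ha0, ha, rfl⟩ := hy
  refine ⟨a ^ D.p, pow_ne_zero _ ha0, ?_, D.pt_frob a⟩
  rw [map_pow]; exact pow_lt_one₀ (D.absF.nonneg a) ha D.p_prime.ne_zero

/-- The locus is GALOIS-STABLE: `σ(y_a) = y_{σ(a)}` (E-t3's `pt_gal`, `absF_galF`). DERIVED. [claim: Joshi2023ATS2Local, status: disputed] -/
theorem galY_mem_classicalPts (g : G) {y : Y} (hy : y ∈ D.classicalPts) : D.galY g y ∈ D.classicalPts := by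
  obtain ⟨a, ha0, ha, rfl⟩ := hy
  refine ⟨D.galF g a, fun h0 => ha0 ?_, by rw [D.absF_galF]; exact ha, D.pt_gal g a⟩
  have := D.absF_galF g a
  rw [h0, map_zero] at this
  exact (map_eq_zero D.absF).1 this.symm

/-- On the locus the scaling exponent determines `|a|_F`: `|a|_F = |p|_0^{scale (y_a)}` (E-t3's `absK_pt` + `absK_natCast_p`). [folklore] -/
theorem absF_eq_rpow_scale_pt {a : F} (ha0 : a ≠ 0) (ha : D.absF a < 1) :
    D.absF a = D.abs0 (D.p : E0) ^ D.scale (D.pt a) := by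
  rw [← D.absK_pt a ha0 ha, D.absK_natCast_p]

/-- **No genuine point is φ-fixed**: `φ(y) ≠ y` on the degree-one locus (§6.6 p. 16 l. 29–36: the fibres of `Y → X` are the orbits
`{([φⁿ(t)] − p) : n ∈ ℤ}`; in the kernel: `φ(y_a) = y_{a^p}` and `|p|_{K_{y_a}} = |a|_F ≠ |a|_F^p`). DERIVED. [claim: Joshi2023ATS2Local, status: disputed] -/
theorem frobY_ne_self_of_mem_classicalPts {y : Y} (hy : y ∈ D.classicalPts) : D.frobY y ≠ y := by
  obtain ⟨a, ha0, ha, rfl⟩ := hy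
  intro h
  have hap : D.absF (a ^ D.p) < 1 := by rw [map_pow]; exact pow_lt_one₀ (D.absF.nonneg a) ha D.p_prime.ne_zero
  have h1 := D.absF_eq_rpow_scale_pt ha0 ha
  have h2 := D.absF_eq_rpow_scale_pt (pow_ne_zero _ ha0) hap
  rw [D.pt_frob, h, ← h1, map_pow] at h2
  -- `|a|^p = |a|` with `0 < |a| < 1`, `p ≥ 2`: impossible
  have hpos : 0 < D.absF a := D.absF.pos ha0
  have hlt : D.absF a ^ D.p < D.absF a := pow_lt_self_of_lt_one₀ hpos ha D.p_prime.one_lt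
  exact hlt.ne h2

/-- The junk value `pt 1` IS φ-fixed (`pt_frob` at `a = 1`: `1^p = 1`). [folklore] -/
theorem frobY_pt_one : D.frobY (D.pt 1) = D.pt 1 := by
  rw [← D.pt_frob, one_pow]

/-- Hence `pt 1` is NOT a classical point: the total `pt` of the signature has values outside print's `|Y_{F,ℚ_p}|`. DERIVED.
[claim: Joshi2023ATS2Local, status: disputed] -/
theorem pt_one_not_mem_classicalPts : D.pt 1 ∉ D.classicalPts :=
  fun h => D.frobY_ne_self_of_mem_classicalPts h D.frobY_pt_one

/-- **AUTHOR'S REFUTATION of `PtSurjective`** (`Joshi/PrimitiveAnsatzPoints`, same seat, same session): as typed — over ALL of the carrier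
type `Y` — the hypothesis fails for EVERY datum, witnessed by the φ-fixed junk point `pt 1`. The statements of that file taking
`(h : PtSurjective)` are therefore vacuous and are superseded by the `…_of_mem` versions below; print's Lem. 6.2.2 is untouched (its `|Y|`
is `classicalPts`). DERIVED. [claim: Joshi2023ATS2Local, status: disputed] -/
theorem not_ptSurjective : ¬ D.PtSurjective := by
  intro h
  obtain ⟨a, ha0, ha, hpt⟩ := h (D.pt 1)
  exact D.pt_one_not_mem_classicalPts ⟨a, ha0, ha, hpt⟩

/-- The consistent form of the [FF18, Cor. 2.2.9] input: on the degree-one locus every point is a `y_a` — by definition of the locus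
(this is all the signature can carry of it; the content «the locus is everything» lives in print's choice of `Y`). [folklore] -/
theorem exists_pt_eq_of_mem_classicalPts {y : Y} (hy : y ∈ D.classicalPts) : ∃ a : F, a ≠ 0 ∧ D.absF a < 1 ∧ D.pt a = y := hy

end PeriodRingDatum

/-! ## 2. Lem. 6.2.2 on the locus (hypothesis-free), and the locus carries the Ansatz and the correspondence -/

namespace PrototypeDatum

variable (P : PrototypeDatum F B E0 Y K G)

/-- Every coordinate of the tuple of an admissible `a` is a classical point. [folklore] -/
theorem ansatzPt_mem_classicalPts {a : F} (ha : a ∈ P.AnsatzParam) (i : Fin P.lstar) : P.ansatzPt a i ∈ P.classicalPts :=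
  P.pt_mem_classicalPts (P.ansatzParam_pow_sq ha i).1 (P.ansatzParam_pow_sq ha i).2

/-- `Σ̃_F ⊆ |Y_{F,ℚ_p}|^{ℓ⋆}`: the Primitive Ansatz lies in the degree-one locus, coordinatewise (§6.3 p. 15 l. 34–41). DERIVED.
[claim: Joshi2023ATS2Local, status: disputed] -/
theorem primitiveAnsatz_subset {t : Fin P.lstar → Y} (ht : t ∈ P.primitiveAnsatz) (i : Fin P.lstar) : t i ∈ P.classicalPts := by
  obtain ⟨a, ha, rfl⟩ := ht
  exact P.ansatzPt_mem_classicalPts ha i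

/-- The Hecke-type correspondence of Rmk. 6.6.2 relates classical points only. DERIVED. [claim: Joshi2023ATS2Local, status: disputed] -/
theorem heckeCorr_subset {y y' : Y} (h : (y, y') ∈ P.heckeCorr) : y ∈ P.classicalPts ∧ y' ∈ P.classicalPts := by
  obtain ⟨a, ha, i, hq⟩ := h
  obtain ⟨rfl, rfl⟩ := Prod.mk.inj hq
  exact ⟨P.pt_mem_classicalPts ha.1 ha.2, P.ansatzPt_mem_classicalPts ha i⟩

/-- **Lem. 6.2.2 (p. 15 l. 15–26), repaired**: every point of the degree-one locus is the FIRST coordinate of a tuple of `Σ̃_F` («there is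
a tuple … of the sort constructed in Proposition 6.2.1 with `𝔭 = 𝔭_1`»). DERIVED, hypothesis-free — supersedes the vacuous
`exists_tuple_first_eq`. [claim: Joshi2023ATS2Local, status: disputed] -/
theorem exists_tuple_first_eq_of_mem {y : Y} (hy : y ∈ P.classicalPts) : ∃ t ∈ P.primitiveAnsatz, t P.firstIdx = y := by
  obtain ⟨a, ha0, ha, rfl⟩ := hy
  exact P.exists_tuple_first_eq_pt ⟨ha0, ha⟩

/-- Every classical point has a nonempty Hecke divisor (it contains the point). DERIVED — supersedes the vacuous `heckeImage_nonempty`.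
[claim: Joshi2023ATS2Local, status: disputed] -/
theorem heckeImage_nonempty_of_mem {y : Y} (hy : y ∈ P.classicalPts) : (P.heckeImage y).Nonempty := by
  obtain ⟨a, ha0, ha, rfl⟩ := hy
  exact ⟨_, P.pt_mem_heckeImage ⟨ha0, ha⟩⟩

/-- **Lem. 6.2.2, ideal form, repaired**: a classical point `y` has a parameter `a` with `y = y_a`; the tuple of ideals of `a` starts with
`([a] − p)`, all of whose elements vanish at `y` (given `EtaPtTeich`). DERIVED — supersedes the vacuous `exists_idealTuple_first`.
[claim: Joshi2023ATS2Local, status: disputed] -/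
theorem exists_idealTuple_first_of_mem (hη : P.EtaPtTeich) {y : Y} (hy : y ∈ P.classicalPts) :
    ∃ a ∈ P.AnsatzParam, P.pt a = y ∧ P.ansatzIdeal a P.firstIdx = P.primIdeal a ∧
      ∀ b ∈ P.primIdeal a, P.eta (P.pt a) b = 0 := by
  obtain ⟨a, ha0, ha, rfl⟩ := hy
  exact ⟨a, ⟨ha0, ha⟩, rfl, P.ansatzIdeal_first a, fun b hb => P.eta_pt_eq_zero_of_mem_primIdeal hη ha0 ha hb⟩

/-- Conversely the first coordinate of any tuple of `Σ̃_F` is classical: Lem. 6.2.2 is an EQUIVALENCE of the locus with the set of first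
coordinates. DERIVED. [claim: Joshi2023ATS2Local, status: disputed] -/
theorem mem_classicalPts_iff_exists_tuple (y : Y) : y ∈ P.classicalPts ↔ ∃ t ∈ P.primitiveAnsatz, t P.firstIdx = y := by
  refine ⟨P.exists_tuple_first_eq_of_mem, ?_⟩
  rintro ⟨t, ht, rfl⟩
  exact P.primitiveAnsatz_subset ht _

/-! ## 3. The `ℓ⋆` points of a tuple are pairwise DISTINCT (point-side twin of E-t62's `Witt.jIdeal_injective`) -/

/-- The scaling exponents along the tuple of an admissible `a` are pairwise distinct: `scale (y_j) = j²·scale (y_a)` (Thm. 6.9.1 (1),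
E-t3's `scale_ansatzPt`) with `scale (y_a) > 0` and `j ↦ j²` injective. DERIVED. [claim: Joshi2023ATS2Local, status: disputed] -/
theorem scale_ansatzPt_injective {a : F} (ha : a ∈ P.AnsatzParam) :
    Function.Injective fun i : Fin P.lstar => P.scale (P.ansatzPt a i) := by
  intro i i' heq
  have hs := P.scale_pos (P.pt a)
  simp only [P.scale_ansatzPt ha] at heq
  have hii : ((((i : ℕ) + 1) ^ 2 : ℕ) : ℝ) = ((((i' : ℕ) + 1) ^ 2 : ℕ) : ℝ) := mul_right_cancel₀ hs.ne' heq
  have hnat : ((i : ℕ) + 1) ^ 2 = ((i' : ℕ) + 1) ^ 2 := by exact_mod_cast hii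
  have hv : (i : ℕ) + 1 = (i' : ℕ) + 1 := Nat.pow_left_injective two_ne_zero hnat
  exact Fin.ext (by omega)

/-- **The tuple of `a` consists of `ℓ⋆` DIFFERENT points of `Y_{F,ℚ_p}`**: `j ↦ y_{a^{j²}}` is injective (Prop. 6.2.1 / Def. 6.2.3 with
Thm. 6.9.1 (1); cf. Thm. 6.9.1 (4) «the `K_j` need not be topologically isomorphic» [Kedlaya–Temkin], stronger and not typed). The
point-side twin, over E-t3's signature, of E-t62's Witt-level `Witt.jIdeal_injective` (the ideals `𝔭_j` are pairwise distinct).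
DERIVED. [claim: Joshi2023ATS2Local, status: disputed] -/
theorem ansatzPt_injective {a : F} (ha : a ∈ P.AnsatzParam) : Function.Injective (P.ansatzPt a) :=
  fun _ _ h => P.scale_ansatzPt_injective ha (congrArg P.scale h)

/-- Hence distinct labels give distinct points: `y_i ≠ y_{i′}` for `i ≠ i′`. DERIVED. [claim: Joshi2023ATS2Local, status: disputed] -/
theorem ansatzPt_ne {a : F} (ha : a ∈ P.AnsatzParam) {i i' : Fin P.lstar} (h : i ≠ i') : P.ansatzPt a i ≠ P.ansatzPt a i' :=
  fun heq => h (P.ansatzPt_injective ha heq)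

/-- In particular the Hecke divisor of `y_a` contains at least `ℓ⋆` points: `Fin ℓ⋆` embeds into it. DERIVED. [claim: Joshi2023ATS2Local, status: disputed] -/
theorem exists_embedding_heckeImage {a : F} (ha : a ∈ P.AnsatzParam) :
    ∃ f : Fin P.lstar → Y, Function.Injective f ∧ ∀ i, f i ∈ P.heckeImage (P.pt a) :=
  ⟨P.ansatzPt a, P.ansatzPt_injective ha, P.ansatzPt_mem_heckeImage ha⟩

end PrototypeDatum

end Summit.ABC.IUTFork.Joshi

end
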